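import Summits.Schanuel.Schanuel.Theorems.RootDecomp1KOnePointCell07

/-!
# RootDecomp1KOnePointCell — lens 1, generation 39 «ONE-POINT ZERO ESTIMATE + LOG-LOG WALL CELL of 33364» ((1, ℓ₂, ℓ₃, ρ) for every log-log-Liouville ρ) — continuation (RootDecomp1KOnePointCell08): §6 the truncations of `ρ_E` on the skeleton and the three-scale form bound `form_lower_bound_P` (`maxHeartbeats 800000`)

(lens-1 g39 `RootDecomp1KOnePointCell.lean` [HOME/decomp-schanuel-lens-1/g39/RootDecomp1KOnePointCell.lean sha256 4a1f4bc8…4211, 2530 l + OPprobe + OPctrl + NODE-g39.md; NOTE/CLAIM L1801, ACK + CHECKLIST K-g39 L1803, presearch (6) resolved by the critic L1810, NODE L1824 / REQUEST L1825 / RESULT L1826]; port by census-1 gen 16 in ten parts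
`RootDecomp1KOnePointCell01`–`10` — see the PORT NOTE of part 01; `--supports stmt-Schanuel-33364`; rung 0.)
-/

open Complex IntermediateField Polynomial
open Summit.Schanuel.Schanuel.Theorems.RootDecomp1KHyper
open Summit.Schanuel.Schanuel.Theorems.RootDecomp1KHyper.HyperCell
open Summit.Schanuel.Schanuel.Theorems.RootDecomp1KGeneric
open Summit.Schanuel.Schanuel.Theorems.RootDecomp1KRelLiouvilleCell
open Summit.Schanuel.Schanuel.Theorems.RootDecomp1KLogLogCell
open Summit.Schanuel.Schanuel.Theorems.RootDecomp1KTwoBaseCell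
open Summit.Schanuel.Schanuel.Theorems.RootDecomp1KMeasuredWallCell

namespace Summit.Schanuel.Schanuel.Theorems.RootDecomp1KOnePointCell

open LiouvilleNumber
open scoped Nat

/-- Upper bound for the tail in base `m ≥ 2`: `r_k ≤ 2·m^{-(k+1)!}`. -/
private theorem remainder_le' {m : ℝ} (hm : 2 ≤ m) (k : ℕ) : remainder m k ≤ 2 / m ^ (k + 1)! := by
  have m1 : (1 : ℝ) < m := by linarith
  have h := remainder_lt' k m1
  have hhalf : (1 : ℝ) / m ≤ 1 / 2 := one_div_le_one_div_of_le two_pos hm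
  have hpos : (0 : ℝ) < 1 - 1 / m := by linarith
  have hinv : (1 - 1 / m)⁻¹ ≤ 2 := by
    rw [inv_le_comm₀ hpos two_pos]
    linarith
  have hmk : (0 : ℝ) < 1 / m ^ (k + 1)! := by positivity
  calc remainder m k ≤ (1 - 1 / m)⁻¹ * (1 / m ^ (k + 1)!) := h.le
    _ ≤ 2 * (1 / m ^ (k + 1)!) := mul_le_mul_of_nonneg_right hinv hmk.le
    _ = 2 / m ^ (k + 1)! := by ring

/-- `6 ≤ e²`. -/
private theorem six_le_exp_two' : (6 : ℝ) ≤ Real.exp 2 := by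
  have h : Real.exp 2 = Real.exp 1 ^ 2 := by rw [← Real.exp_nat_mul]; norm_num
  rw [h]
  have h1 := Real.exp_one_gt_d9
  calc (6 : ℝ) ≤ (2.7182818283 : ℝ) ^ 2 := by norm_num
    _ ≤ Real.exp 1 ^ 2 := pow_le_pow_left₀ (by norm_num) h1.le 2

section Member
open LiouvilleNumber
open scoped Nat

/-! ### The truncations of `ρ_E` on the skeleton `{2^{-k!}}` -/

/-- The truncation of `ρ_E` at scale `K`: `T_K := Σ_{k ≤ K} 1_T(k) / 2^{k!}`. -/
noncomputable def rhoEps (K : ℕ) : ℝ := ∑ k ∈ Finset.range (K + 1), (eInd k : ℝ) / (2 : ℝ) ^ k !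

/-- The skeleton indicator `eInd k` is `≥ 0`. -/
theorem eInd_nonneg (k : ℕ) : 0 ≤ eInd k := by
  unfold eInd; split_ifs <;> simp

/-- The skeleton indicator `eInd k` is `≤ 1`. -/
theorem eInd_le_one (k : ℕ) : eInd k ≤ 1 := by
  unfold eInd; split_ifs <;> simp

/-- The skeleton series `Σ eInd k / 2^{k!}` is summable. -/
private theorem summable_eInd' : Summable fun k : ℕ => (eInd k : ℝ) / (2 : ℝ) ^ k ! := by
  refine Summable.of_nonneg_of_le (fun k => div_nonneg (by exact_mod_cast eInd_nonneg k) (by positivity))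
    (fun k => ?_) (LiouvilleNumber.summable (by norm_num : (1 : ℝ) < 2))
  exact div_le_div_of_nonneg_right (by exact_mod_cast eInd_le_one k) (by positivity)

/-- `T_{K+1} = T_K + 1_T(K+1) / 2^{(K+1)!}`. -/
theorem rhoEps_succ (K : ℕ) : rhoEps (K + 1) = rhoEps K + (eInd (K + 1) : ℝ) / (2 : ℝ) ^ (K + 1)! := by
  unfold rhoEps; rw [Finset.sum_range_succ]

/-- Tail: `0 ≤ ρ_E − T_K ≤ 2 / 2^{(K+1)!}`. -/
theorem rhoE_sub_rhoEps (K : ℕ) :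
    0 ≤ rhoE - rhoEps K ∧ rhoE - rhoEps K ≤ 2 / (2 : ℝ) ^ (K + 1)! := by
  have hs := summable_eInd'
  have hsplit := (hs.sum_add_tsum_nat_add (K + 1)).symm
  have htail_eq : rhoE - rhoEps K = ∑' k, (eInd (k + (K + 1)) : ℝ) / (2 : ℝ) ^ (k + (K + 1))! := by
    rw [rhoE_eq_tsum_eInd, hsplit, rhoEps]; ring
  have hs' : Summable fun k => (eInd (k + (K + 1)) : ℝ) / (2 : ℝ) ^ (k + (K + 1))! :=
    (summable_nat_add_iff (f := fun k => (eInd k : ℝ) / (2 : ℝ) ^ k !) (K + 1)).mpr hs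
  have hrem : Summable fun k : ℕ => 1 / (2 : ℝ) ^ (k + (K + 1))! := remainder_summable (by norm_num) K
  have hrem_le : ∑' k : ℕ, 1 / (2 : ℝ) ^ (k + (K + 1))! ≤ 2 / 2 ^ (K + 1)! := by
    have h := remainder_le' (m := 2) (by norm_num) K
    unfold remainder at h
    exact h
  have hle : ∀ k : ℕ, (eInd (k + (K + 1)) : ℝ) / (2 : ℝ) ^ (k + (K + 1))! ≤ 1 / (2 : ℝ) ^ (k + (K + 1))! :=
    fun k => div_le_div_of_nonneg_right (by exact_mod_cast eInd_le_one _) (by positivity)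
  have hnn : ∀ k : ℕ, 0 ≤ (eInd (k + (K + 1)) : ℝ) / (2 : ℝ) ^ (k + (K + 1))! :=
    fun k => div_nonneg (by exact_mod_cast eInd_nonneg _) (by positivity)
  rw [htail_eq]
  exact ⟨tsum_nonneg hnn, (Summable.tsum_le_tsum hle hs' hrem).trans hrem_le⟩

/-- `T_K = A / 2^{K!}` with `A ∈ ℤ`. -/
theorem rhoEps_eq_div (K : ℕ) : ∃ A : ℤ, rhoEps K = (A : ℝ) / (2 : ℝ) ^ K ! := by
  refine ⟨∑ k ∈ Finset.range (K + 1), eInd k * 2 ^ (K.factorial - k.factorial), ?_⟩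
  unfold rhoEps
  push_cast
  rw [Finset.sum_div]
  refine Finset.sum_congr rfl fun k hk => ?_
  have hk' : k.factorial ≤ K.factorial := Nat.factorial_le (by have := Finset.mem_range.mp hk; omega)
  rw [pow_sub₀ _ (by norm_num : (2 : ℝ) ≠ 0) hk']
  field_simp

/-! ### The three-scale form bound for `(1, ℓ₂, ℓ₃, ρ_E)` -/

/-- Approximation at scale `K`: `|φ − Φ_K| ≤ 2H · 2^{−(K+1)!}`. -/
private theorem formP_approx (g : Fin 4 → ℤ) (K : ℕ) :
    |((g 0 : ℝ) + g 1 * liouvilleNumber 2 + g 2 * liouvilleNumber 3 + g 3 * rhoE) -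
      ((g 0 : ℝ) + g 1 * partialSum 2 K + g 2 * partialSum 3 K + g 3 * rhoEps K)| ≤
      2 * (∑ i, (|g i| : ℝ)) / 2 ^ (K + 1)! := by
  have h2 := partialSum_add_remainder (by norm_num : (1 : ℝ) < 2) K
  have h3 := partialSum_add_remainder (by norm_num : (1 : ℝ) < 3) K
  have r2le : remainder 2 K ≤ 2 / 2 ^ (K + 1)! := remainder_le' (by norm_num) K
  have r3le : remainder 3 K ≤ 2 / 2 ^ (K + 1)! := by
    refine (remainder_le' (by norm_num) K).trans ?_
    gcongr; norm_num
  have r2pos := remainder_pos (by norm_num : (1 : ℝ) < 2) K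
  have r3pos := remainder_pos (by norm_num : (1 : ℝ) < 3) K
  obtain ⟨rTnn, rTle⟩ := rhoE_sub_rhoEps K
  have e : ((g 0 : ℝ) + g 1 * liouvilleNumber 2 + g 2 * liouvilleNumber 3 + g 3 * rhoE) -
      ((g 0 : ℝ) + g 1 * partialSum 2 K + g 2 * partialSum 3 K + g 3 * rhoEps K) =
      g 1 * remainder 2 K + g 2 * remainder 3 K + g 3 * (rhoE - rhoEps K) := by rw [← h2, ← h3]; ring
  rw [e]
  have hsum : |(g 1 : ℝ)| + |(g 2 : ℝ)| + |(g 3 : ℝ)| ≤ ∑ i, (|g i| : ℝ) := by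
    rw [Fin.sum_univ_four]; linarith [abs_nonneg (g 0 : ℝ)]
  calc |(g 1 : ℝ) * remainder 2 K + g 2 * remainder 3 K + g 3 * (rhoE - rhoEps K)|
      ≤ |(g 1 : ℝ) * remainder 2 K + g 2 * remainder 3 K| + |(g 3 : ℝ) * (rhoE - rhoEps K)| :=
        abs_add_le _ _
    _ ≤ |(g 1 : ℝ) * remainder 2 K| + |(g 2 : ℝ) * remainder 3 K| + |(g 3 : ℝ) * (rhoE - rhoEps K)| := by
        gcongr; exact abs_add_le _ _
    _ = |(g 1 : ℝ)| * remainder 2 K + |(g 2 : ℝ)| * remainder 3 K + |(g 3 : ℝ)| * (rhoE - rhoEps K) := by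
        rw [abs_mul, abs_mul, abs_mul, abs_of_pos r2pos, abs_of_pos r3pos, abs_of_nonneg rTnn]
    _ ≤ |(g 1 : ℝ)| * (2 / 2 ^ (K + 1)!) + |(g 2 : ℝ)| * (2 / 2 ^ (K + 1)!) +
        |(g 3 : ℝ)| * (2 / 2 ^ (K + 1)!) := by gcongr
    _ = 2 * (|(g 1 : ℝ)| + |(g 2 : ℝ)| + |(g 3 : ℝ)|) / 2 ^ (K + 1)! := by ring
    _ ≤ 2 * (∑ i, (|g i| : ℝ)) / 2 ^ (K + 1)! := by gcongr

/-- Scale lower bound: a NON-ZERO value `Φ_K = g₀ + g₁ s²_K + g₂ s³_K + g₃ T_K` is `≥ 6^{−K!}`. -/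
private theorem formP_scale_lower (g : Fin 4 → ℤ) (K : ℕ)
    (hne : (g 0 : ℝ) + g 1 * partialSum 2 K + g 2 * partialSum 3 K + g 3 * rhoEps K ≠ 0) :
    1 / (6 : ℝ) ^ K ! ≤ |(g 0 : ℝ) + g 1 * partialSum 2 K + g 2 * partialSum 3 K + g 3 * rhoEps K| := by
  obtain ⟨p2, hp2⟩ := partialSum_eq_rat (by norm_num : 0 < 2) K
  obtain ⟨p3, hp3⟩ := partialSum_eq_rat (by norm_num : 0 < 3) K
  push_cast at hp2 hp3
  obtain ⟨A, hA⟩ := rhoEps_eq_div K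
  set I : ℤ := g 0 * 6 ^ K ! + g 1 * p2 * 3 ^ K ! + g 2 * p3 * 2 ^ K ! + g 3 * A * 3 ^ K ! with hI
  have h6 : (6 : ℝ) ^ K ! = 2 ^ K ! * 3 ^ K ! := by rw [← mul_pow]; norm_num
  have hΦ : (g 0 : ℝ) + g 1 * partialSum 2 K + g 2 * partialSum 3 K + g 3 * rhoEps K =
      (I : ℝ) / 6 ^ K ! := by
    rw [hp2, hp3, hA, hI, eq_div_iff (by positivity)]
    push_cast
    rw [h6]
    field_simp
  rw [hΦ] at hne ⊢
  have hI0 : I ≠ 0 := by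
    intro h0; apply hne; rw [h0]; simp
  have hI1 : (1 : ℝ) ≤ |(I : ℝ)| := by exact_mod_cast Int.one_le_abs hI0
  rw [abs_div, abs_of_pos (by positivity : (0 : ℝ) < 6 ^ K !)]
  exact div_le_div_of_nonneg_right hI1 (by positivity)

/-- **Two scales force `g₂ = 0`:** if `Φ_N = Φ_{N+1} = 0` then
`(g₁ + g₃ 1_T(N+1)) 3^{(N+1)!} + g₂ 2^{(N+1)!} = 0`, so `2^{(N+1)!} ∣ g₁ + g₃ 1_T(N+1)`; with
`|g₁| + |g₃| < 2^{(N+1)!}` that digit vanishes, hence `g₂ = 0`. -/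
private theorem formP_two_scale (g : Fin 4 → ℤ) (N : ℕ)
    (h0 : (g 0 : ℝ) + g 1 * partialSum 2 N + g 2 * partialSum 3 N + g 3 * rhoEps N = 0)
    (h1 : (g 0 : ℝ) + g 1 * partialSum 2 (N + 1) + g 2 * partialSum 3 (N + 1) +
      g 3 * rhoEps (N + 1) = 0)
    (hsmall : |g 1| + |g 3| < (2 : ℤ) ^ (N + 1)!) : g 2 = 0 := by
  rw [partialSum_succ, partialSum_succ, rhoEps_succ] at h1
  set c : ℤ := g 1 + g 3 * eInd (N + 1) with hc
  have hd : (c : ℝ) / 2 ^ (N + 1)! + g 2 / 3 ^ (N + 1)! = 0 := by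
    rw [hc]; push_cast; linear_combination h1 - h0
  have hz : (c : ℝ) * 3 ^ (N + 1)! + g 2 * 2 ^ (N + 1)! = 0 := by
    have h2 : (2 : ℝ) ^ (N + 1)! ≠ 0 := by positivity
    have h3 : (3 : ℝ) ^ (N + 1)! ≠ 0 := by positivity
    field_simp at hd
    linear_combination hd
  have hzZ : c * 3 ^ (N + 1)! + g 2 * 2 ^ (N + 1)! = (0 : ℤ) := by exact_mod_cast hz
  have hdvd : (2 : ℤ) ^ (N + 1)! ∣ c * 3 ^ (N + 1)! := ⟨-(g 2), by linear_combination hzZ⟩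
  have hcop : IsCoprime ((2 : ℤ) ^ (N + 1)!) ((3 : ℤ) ^ (N + 1)!) :=
    (show IsCoprime (2 : ℤ) 3 from ⟨-1, 1, by norm_num⟩).pow
  have hcabs : |c| < (2 : ℤ) ^ (N + 1)! := by
    have hle : |c| ≤ |g 1| + |g 3| := by
      rw [hc]
      calc |g 1 + g 3 * eInd (N + 1)| ≤ |g 1| + |g 3 * eInd (N + 1)| := abs_add_le _ _
        _ = |g 1| + |g 3| * |eInd (N + 1)| := by rw [abs_mul]
        _ ≤ |g 1| + |g 3| * 1 := by gcongr; exact abs_eInd_le _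
        _ = |g 1| + |g 3| := by ring
    exact lt_of_le_of_lt hle hsmall
  have hc0 : c = 0 := Int.eq_zero_of_abs_lt_dvd (hcop.dvd_of_dvd_mul_right hdvd) hcabs
  rw [hc0, zero_mul, zero_add] at hzZ
  exact (mul_eq_zero.mp hzZ).resolve_right (pow_ne_zero _ (by norm_num))

/-- `2 ≤ e`. -/
private theorem two_le_exp_one' : (2 : ℝ) ≤ Real.exp 1 := by
  have := Real.exp_one_gt_d9; linarith

set_option maxHeartbeats 800000 in
/-- **THE THREE-SCALE FORM BOUND** (hypothesis-free): every non-zero integer form in `(1, ℓ₂, ℓ₃, ρ_E)`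
satisfies `exp(−(1+Σ|gᵢ|)^11) ≤ |g₀ + g₁ℓ₂ + g₂ℓ₃ + g₃ρ_E|`.  If `g₂ = 0` this is the shared-digit certificate
`formE_lower_bound` of `(1, ℓ₂, ρ_E)` (g34).  If `g₂ ≠ 0`: scale `N ≥ 3` least with `4H ≤ 2^{N!}`; at one of the
scales `N, N+1` the truncated form is non-zero (`formP_two_scale`), hence `≥ 6^{−K!}`, twice the
approximation error; and `(N+1)! ≤ 64 (1+H)^3` by minimality. -/
theorem form_lower_bound_P (g : Fin 4 → ℤ) (hg : g ≠ 0) :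
    Real.exp (-((1 + ∑ i, (|g i| : ℝ)) ^ 11)) ≤
      |(g 0 : ℝ) + g 1 * liouvilleNumber 2 + g 2 * liouvilleNumber 3 + g 3 * rhoE| := by
  classical
  set HR : ℝ := ∑ i, (|g i| : ℝ) with hHR
  have hHR4 : HR = |(g 0 : ℝ)| + |(g 1 : ℝ)| + |(g 2 : ℝ)| + |(g 3 : ℝ)| := by
    rw [hHR, Fin.sum_univ_four]
  have hHR0 : 0 ≤ HR := by
    rw [hHR]; exact Finset.sum_nonneg fun i _ => by exact_mod_cast abs_nonneg (g i)
  by_cases hg2 : g 2 = 0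
  · -- `φ` is a form in `(1, ℓ₂, ρ_E)`: the shared-digit certificate of g34
    set h : Fin 3 → ℤ := ![g 0, g 1, g 3] with hh
    have hh0 : h ≠ 0 := by
      intro h0
      have e0 : g 0 = 0 := by have := congr_fun h0 0; simpa [hh] using this
      have e1 : g 1 = 0 := by have := congr_fun h0 1; simpa [hh] using this
      have e3 : g 3 = 0 := by have := congr_fun h0 2; simpa [hh] using this
      apply hg; funext i
      fin_cases i <;> simp [e0, e1, hg2, e3]
    have hlow := formE_lower_bound h hh0
    have eh0 : h 0 = g 0 := rfl
    have eh1 : h 1 = g 1 := rfl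
    have eh2 : h 2 = g 3 := rfl
    have hsum3 : ∑ i, (|h i| : ℝ) = |(g 0 : ℝ)| + |(g 1 : ℝ)| + |(g 3 : ℝ)| := by
      rw [Fin.sum_univ_three, eh0, eh1, eh2]
    rw [hsum3, eh0, eh1, eh2] at hlow
    rw [hg2, Int.cast_zero, zero_mul, add_zero]
    refine le_trans (Real.exp_le_exp.mpr (neg_le_neg ?_)) hlow
    refine pow_le_pow_left₀ (by positivity) ?_ 11
    rw [hHR4]; linarith [abs_nonneg (g 2 : ℝ)]
  · -- `g₂ ≠ 0`: two consecutive scales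
    have hexp1 : Real.exp (-((1 + HR) ^ 11)) ≤ 1 := by
      rw [Real.exp_le_one_iff]
      have : (0 : ℝ) ≤ (1 + HR) ^ 11 := by positivity
      linarith
    -- the natural height `Hn` and the scale `N = K₀ + 3`
    set Hn : ℕ := ∑ i, (g i).natAbs with hHn
    have hHRn : HR = (Hn : ℝ) := by
      rw [hHR, hHn, Nat.cast_sum]
      refine Finset.sum_congr rfl fun i _ => ?_
      simp only [Nat.cast_natAbs, Int.cast_abs]
    have hHn4 : Hn = (g 0).natAbs + (g 1).natAbs + (g 2).natAbs + (g 3).natAbs := by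
      rw [hHn, Fin.sum_univ_four]
    have hHn1 : 1 ≤ Hn := by
      have h1 : 1 ≤ (g 2).natAbs := Int.natAbs_pos.mpr hg2
      omega
    have hex : ∃ K : ℕ, 4 * Hn ≤ 2 ^ (K + 3)! := by
      refine ⟨4 * Hn, (Nat.lt_two_pow_self).le.trans (Nat.pow_le_pow_right (by norm_num) ?_)⟩
      exact (Nat.le_add_right _ _).trans (Nat.self_le_factorial _)
    set K₀ : ℕ := Nat.find hex with hK₀
    have hK₀spec : 4 * Hn ≤ 2 ^ (K₀ + 3)! := Nat.find_spec hex
    set N : ℕ := K₀ + 3 with hN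
    have hN3 : 3 ≤ N := by omega
    have hHN : 4 * Hn ≤ 2 ^ N ! := hK₀spec
    -- `(N+1)! ≤ 64 (1+Hn)^3`
    have hfac : (N + 1)! ≤ 64 * (1 + Hn) ^ 3 := by
      rcases Nat.eq_zero_or_pos K₀ with hz | hpos
      · have h24 : (N + 1)! = 24 := by rw [hN, hz]; rfl
        have h1 : 1 ≤ (1 + Hn) ^ 3 := Nat.one_le_pow _ _ (by omega)
        omega
      · have hmin := Nat.find_min hex (m := K₀ - 1) (by omega)
        rw [show K₀ - 1 + 3 = K₀ + 2 by omega] at hmin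
        have hlt : (K₀ + 2)! < 4 * Hn := (Nat.lt_two_pow_self).trans (not_le.mp hmin)
        have hK2 : K₀ + 2 ≤ (K₀ + 2)! := Nat.self_le_factorial _
        rw [hN, show K₀ + 3 + 1 = (K₀ + 2) + 1 + 1 by omega, Nat.factorial_succ, Nat.factorial_succ]
        have h1 : K₀ + 2 + 1 + 1 ≤ 4 * (1 + Hn) := by omega
        have h2 : K₀ + 2 + 1 ≤ 4 * (1 + Hn) := by omega
        have h3 : (K₀ + 2)! ≤ 4 * (1 + Hn) := by omega
        calc (K₀ + 2 + 1 + 1) * ((K₀ + 2 + 1) * (K₀ + 2)!)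
            ≤ (4 * (1 + Hn)) * ((4 * (1 + Hn)) * (4 * (1 + Hn))) :=
              Nat.mul_le_mul h1 (Nat.mul_le_mul h2 h3)
          _ = 64 * (1 + Hn) ^ 3 := by ring
    have hfacR : (((N + 1)! : ℕ) : ℝ) ≤ 64 * (1 + HR) ^ 3 := by
      rw [hHRn]; exact_mod_cast hfac
    -- `|g₁| + |g₃| < 2^{(N+1)!}`
    have hsmall : |g 1| + |g 3| < (2 : ℤ) ^ (N + 1)! := by
      have h2 : Hn < 2 ^ N ! := by have := Nat.two_pow_pos (N !); omega
      have h3 : 2 ^ N ! ≤ 2 ^ (N + 1)! := Nat.pow_le_pow_right (by norm_num) (Nat.factorial_le (by omega))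
      have h4 : (g 1).natAbs + (g 3).natAbs < 2 ^ (N + 1)! := by omega
      have h5 : (((g 1).natAbs + (g 3).natAbs : ℕ) : ℤ) < ((2 ^ (N + 1)! : ℕ) : ℤ) := by
        exact_mod_cast h4
      rwa [Nat.cast_add, Int.natCast_natAbs, Int.natCast_natAbs, Nat.cast_pow, Nat.cast_ofNat] at h5
    -- at a scale `K ∈ {N, N+1}` where the truncated form is non-zero, conclude
    have key : ∀ K, N ≤ K → K ≤ N + 1 →
        (g 0 : ℝ) + g 1 * partialSum 2 K + g 2 * partialSum 3 K + g 3 * rhoEps K ≠ 0 →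
        Real.exp (-((1 + HR) ^ 11)) ≤
          |(g 0 : ℝ) + g 1 * liouvilleNumber 2 + g 2 * liouvilleNumber 3 + g 3 * rhoE| := by
      intro K hNK hKN hne
      have hK3 : 3 ≤ K := hN3.trans hNK
      have hlowK := formP_scale_lower g K hne
      have happK := formP_approx g K
      rw [← hHR] at happK
      -- separation: `2 · (2H/2^{(K+1)!}) ≤ 1/6^{K!}`
      have hA : 4 * HR ≤ (2 : ℝ) ^ K ! := by
        rw [hHRn]
        have : 4 * Hn ≤ 2 ^ K ! := hHN.trans (Nat.pow_le_pow_right (by norm_num) (Nat.factorial_le hNK))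
        exact_mod_cast this
      have hB : (6 : ℝ) ^ K ! ≤ (2 ^ K) ^ K ! := by
        refine pow_le_pow_left₀ (by norm_num) ?_ _
        calc (6 : ℝ) ≤ 2 ^ 3 := by norm_num
          _ ≤ 2 ^ K := pow_le_pow_right₀ (by norm_num) hK3
      have hB' : ((2 : ℝ) ^ K) ^ K ! = (2 ^ K !) ^ K := by rw [← pow_mul, ← pow_mul, mul_comm]
      have hC : (2 : ℝ) ^ (K + 1)! = 2 ^ K ! * (2 ^ K !) ^ K := by
        rw [Nat.factorial_succ, show (K + 1) * K ! = K ! * (K + 1) by ring, pow_mul, pow_succ]; ring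
      have hsep : 2 * (2 * HR / 2 ^ (K + 1)!) ≤ 1 / (6 : ℝ) ^ K ! := by
        rw [← mul_div_assoc, div_le_div_iff₀ (by positivity) (by positivity), one_mul]
        calc 2 * (2 * HR) * (6 : ℝ) ^ K ! = (4 * HR) * 6 ^ K ! := by ring
          _ ≤ 2 ^ K ! * (2 ^ K) ^ K ! := mul_le_mul hA hB (by positivity) (by positivity)
          _ = 2 ^ K ! * (2 ^ K !) ^ K := by rw [hB']
          _ = 2 ^ (K + 1)! := hC.symm
      -- `|φ| ≥ |Φ_K| − |φ − Φ_K| ≥ (1/6^{K!})/2`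
      have hφK : 1 / (6 : ℝ) ^ K ! / 2 ≤
          |(g 0 : ℝ) + g 1 * liouvilleNumber 2 + g 2 * liouvilleNumber 3 + g 3 * rhoE| := by
        have ht := abs_sub_abs_le_abs_sub
          ((g 0 : ℝ) + g 1 * partialSum 2 K + g 2 * partialSum 3 K + g 3 * rhoEps K)
          ((g 0 : ℝ) + g 1 * liouvilleNumber 2 + g 2 * liouvilleNumber 3 + g 3 * rhoE)
        rw [abs_sub_comm] at ht
        linarith
      refine le_trans ?_ hφK
      -- `exp(−(1+H)^11) ≤ (1/6^{K!})/2`: `2·6^{K!} ≤ exp(1 + 2K!) ≤ exp((1+H)^11)`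
      have hKfac : ((K ! : ℕ) : ℝ) ≤ 64 * (1 + HR) ^ 3 := by
        have h1 : K ! ≤ (N + 1)! := Nat.factorial_le hKN
        have h2 : ((K ! : ℕ) : ℝ) ≤ (((N + 1)! : ℕ) : ℝ) := by exact_mod_cast h1
        exact h2.trans hfacR
      have hX1 : (1 : ℝ) ≤ HR := by rw [hHRn]; exact_mod_cast hHn1
      have hX2 : (2 : ℝ) ≤ 1 + HR := by linarith
      have hX3 : (8 : ℝ) ≤ (1 + HR) ^ 3 := by
        have := pow_le_pow_left₀ (by norm_num) hX2 3
        norm_num at this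
        linarith
      have hX8 : (256 : ℝ) ≤ (1 + HR) ^ 8 := by
        have := pow_le_pow_left₀ (by norm_num) hX2 8
        norm_num at this
        linarith
      have hpoly : 1 + 2 * ((K ! : ℕ) : ℝ) ≤ (1 + HR) ^ 11 := by
        have e : (1 + HR) ^ 11 = (1 + HR) ^ 8 * (1 + HR) ^ 3 := by ring
        rw [e]
        nlinarith
      have hexpK : 2 * (6 : ℝ) ^ K ! ≤ Real.exp ((1 + HR) ^ 11) := by
        calc 2 * (6 : ℝ) ^ K ! ≤ Real.exp 1 * Real.exp 2 ^ K ! :=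
              mul_le_mul two_le_exp_one' (pow_le_pow_left₀ (by norm_num) six_le_exp_two' _)
                (by positivity) (Real.exp_pos _).le
          _ = Real.exp (1 + 2 * ((K ! : ℕ) : ℝ)) := by
              rw [← Real.exp_nat_mul, ← Real.exp_add]; ring_nf
          _ ≤ Real.exp ((1 + HR) ^ 11) := Real.exp_le_exp.mpr hpoly
      rw [Real.exp_neg, div_div, one_div]
      exact inv_anti₀ (by positivity) (by linarith [hexpK])
    by_cases hΦN : (g 0 : ℝ) + g 1 * partialSum 2 N + g 2 * partialSum 3 N + g 3 * rhoEps N = 0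
    · have hΦN1 : (g 0 : ℝ) + g 1 * partialSum 2 (N + 1) + g 2 * partialSum 3 (N + 1) +
          g 3 * rhoEps (N + 1) ≠ 0 :=
        fun h1 => hg2 (formP_two_scale g N hΦN h1 hsmall)
      exact key (N + 1) (Nat.le_succ N) le_rfl hΦN1
    · exact key N le_rfl (Nat.le_succ N) hΦN

end Member

end Summit.Schanuel.Schanuel.Theorems.RootDecomp1KOnePointCell
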